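import Literature.Topology.PlaneTopology.WindingNumber
import HarnessLib

/-!
# N1 ▸ `node_N1_move` ▸ (d) N1-mono ▸ piece (d9), brick J2-7: THE CONTINUOUS PHASE OF THE CORE ANGLE OF A CHART FAMILY
(wave 8, crux stmt-SmoothPoincare4-10508, line `modp-braid-orbits`, registered stub `stub_M2geo` (N1) ▸
`node_N1_move` ▸ sub-node (d) `helper_N1_beltMonodromy` ▸ piece (d9); registered sub-goal `helper_corePhase_lift`;
the input `L` of brick J2-5 `helper_returnMap_rectangleWinding`)

The fibred chart family `φ : ℝ × ℝ × ℝ → Base g` of the (d) statement, read in the Kosinski tube of the handle, has a core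
ANGLE `V (u', r', σ) ∈ 𝕊¹` (as a unit complex number), continuous, `1`-periodic in `u'`, equal to `e^{2πiu'}` on the core
`(r', σ) = (0, 0)` (`φ (u, 0, 0) = γ_k (circlePt u)`).  Such a map has a continuous PHASE `L` with
`V = ‖V‖ e^{2πi (u' + L)}`, `L` `1`-periodic in `u'` and `L = 0` on the core (`helper_corePhase_lift`): logarithm on the simply
connected `ℝ³` (`hasLogOn_univ`), uniqueness of logarithms along the core and under the deck shift `u' ↦ u' + 1`.  This `L` is
the phase fed to `helper_returnMap_rectangleWinding` (brick J2-5), which turns piece (d9) into a winding number.  Everything is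
proved; no named facts, no `sorry`.  Reference: A. Hatcher, *Algebraic Topology* (2002), §1.1, Prop. 1.30 [HatcherAT2002].
-/

noncomputable section

set_option linter.dupNamespace false

open Set Function Complex Filter
open Literature.Topology.PlaneTopology

namespace Summit.SmoothPoincare4.SmoothPoincare4.Theorems.AcyclicBisectionExists.ModpBraidOrbits

/-- `ℝ³` (as `ℝ × ℝ × ℝ`) is simply connected. [folklore] -/
theorem isSimplyConnected_univ_real3 : IsSimplyConnected (univ : Set (ℝ × ℝ × ℝ)) := by
  have : ContractibleSpace (univ : Set (ℝ × ℝ × ℝ)) := (convex_univ).contractibleSpace ⟨0, trivial⟩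
  change SimplyConnectedSpace (univ : Set (ℝ × ℝ × ℝ))
  infer_instance

/-- **THE CONTINUOUS PHASE OF A PERIODIC CIRCLE-VALUED MAP ON `ℝ³` WITH STANDARD CORE**: a continuous nowhere-zero
`V : ℝ × ℝ × ℝ → ℂ`, `1`-periodic in the first variable and equal to `e^{2πiu}` at `(u, 0, 0)`, is `‖V‖ · e^{2πi (u + L)}` for a
continuous `L`, `1`-periodic in `u`, vanishing at `(u, 0, 0)`. [cite: HatcherAT2002, Prop. 1.30] -/
theorem helper_corePhase_lift : ∀ (V : ℝ × ℝ × ℝ → ℂ), Continuous V → (∀ p : ℝ × ℝ × ℝ, V p ≠ 0) → (∀ u r σ : ℝ, V (u + 1, r, σ) = V (u, r, σ)) → (∀ u : ℝ, V (u, 0, 0) = Complex.exp (2 * Real.pi * Complex.I * (u : ℂ))) → ∃ L : ℝ × ℝ × ℝ → ℝ, Continuous L ∧ (∀ u r σ : ℝ, L (u + 1, r, σ) = L (u, r, σ)) ∧ (∀ u : ℝ, L (u, 0, 0) = 0) ∧ ∀ p : ℝ × ℝ × ℝ, V p = (‖V p‖ : ℂ) * Complex.exp (2 * Real.pi * Complex.I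 * ((p.1 + L p : ℝ) : ℂ)) := by
  intro V hV hne hper hcore
  obtain ⟨l, hlc, hle⟩ := hasLogOn_univ isSimplyConnected_univ_real3 hV hne
  have hl : Continuous l := continuousOn_univ.1 hlc
  have hle' : ∀ p, exp (l p) = V p := fun p => hle p (mem_univ p)
  -- along the core the logarithm is `2πiu` up to a constant integer
  obtain ⟨n, hn⟩ := exists_int_eq_add_of_exp_eq (s := (univ : Set ℝ)) isPreconnected_univ
    (l := fun u : ℝ => l (u, 0, 0)) (m := fun u : ℝ => 2 * Real.pi * I * (u : ℂ))
    ((hl.comp (by fun_prop)).continuousOn) (by fun_prop) (fun u _ => by rw [hle', hcore])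
  -- under the deck shift the logarithm changes by a constant integer
  obtain ⟨m, hm⟩ := exists_int_eq_add_of_exp_eq (s := (univ : Set (ℝ × ℝ × ℝ))) isPreconnected_univ
    (l := fun p : ℝ × ℝ × ℝ => l (p.1 + 1, p.2.1, p.2.2)) (m := l)
    ((hl.comp (by fun_prop)).continuousOn) hlc (fun p _ => by rw [hle', hle', hper])
  refine ⟨fun p => (l p).im / (2 * Real.pi) - p.1 - n, ?_, ?_, ?_, ?_⟩
  · exact (((Complex.continuous_im.comp hl).div_const _).sub continuous_fst).sub continuous_const
  · -- periodicity: the deck integer `m` is `1` (evaluate at the core)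
    have h0 := hm (0, 0, 0) (mem_univ _)
    have hn0 := hn 0 (mem_univ _)
    have hn1 := hn 1 (mem_univ _)
    simp only at h0 hn0 hn1
    rw [zero_add] at h0
    have hm1 : (m : ℂ) = 1 := by
      have e : (m : ℂ) * (2 * Real.pi * I) = 1 * (2 * Real.pi * I) := by
        rw [hn1, hn0] at h0
        simp only [Complex.ofReal_one, Complex.ofReal_zero, mul_one, mul_zero, zero_add] at h0
        linear_combination -h0
      exact mul_right_cancel₀ (by simp [Real.pi_ne_zero, I_ne_zero]) e
    intro u r σ
    have h := hm (u, r, σ) (mem_univ _)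
    simp only at h
    dsimp only
    rw [h, hm1, one_mul, Complex.add_im]
    have him : (2 * (Real.pi : ℂ) * I).im = 2 * Real.pi := by simp
    rw [him]
    field_simp
    ring
  · intro u
    have h := hn u (mem_univ _)
    dsimp only
    rw [h]
    have him : (2 * (Real.pi : ℂ) * I * (u : ℂ) + (n : ℂ) * (2 * Real.pi * I)).im = 2 * Real.pi * u + n * (2 * Real.pi) := by
      simp
    rw [him]
    field_simp
    ring
  · intro p
    have hV : V p = exp (l p) := (hle' p).symm
    have hnorm : ‖V p‖ = Real.exp (l p).re := by rw [hV, Complex.norm_exp]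
    rw [hnorm, hV]
    conv_lhs => rw [← Complex.re_add_im (l p), Complex.exp_add]
    congr 1
    · rw [Complex.ofReal_exp]
    · have e : 2 * Real.pi * I * ((p.1 + ((l p).im / (2 * Real.pi) - p.1 - n) : ℝ) : ℂ) =
          (l p).im * I - (n : ℂ) * (2 * Real.pi * I) := by
        push_cast
        field_simp
        ring
      rw [e, Complex.exp_sub, Complex.exp_int_mul_two_pi_mul_I, div_one]

end Summit.SmoothPoincare4.SmoothPoincare4.Theorems.AcyclicBisectionExists.ModpBraidOrbits

end
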